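import Literature.AnabelianGeometry.SemiGraphs.UniversalCoveringOverMap
import Literature.AnabelianGeometry.SemiGraphs.UniversalCoveringConnected
import Literature.AnabelianGeometry.SemiGraphs.OrbitGraphOrbits

/-!
# Path lifting for `𝔾_T → 𝔾_S` and fibre-surjectivity of `𝒢_{∞,T} → 𝒢_{∞,S}` ([SemiAnbd] §3 p. 38)

For a morphism `f : T ⟶ S` of coverings, every path class of `𝔾_S` starting at the image `f̄ W`
of a vertex-orbit `W` of `𝔾_T` lifts to a path class of `𝔾_T` starting at `W` (`exists_lift`): the
orbits of `T` over a vertex map ONTO the corresponding orbits of `S` (equivariance), so the arrows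
of `Cat(𝔾_S)` at an image vertex lift.  Consequently `π : 𝒢_{∞,T} → 𝒢_{∞,S}`
(`univCoverOverMap f`) is surjective on every vertex fibre (`univCoverOverMap_fV_surjective`) —
the surjectivity of the "compatible maps `𝒢_{∞,j} → 𝒢_{∞,i}`" of [SemiAnbd] p. 38.
-/

namespace Literature.AnabelianGeometry.SemiGraphs

namespace ProfiniteSemiGraph

open CategoryTheory

universe u

variable {𝒢 : ProfiniteSemiGraph.{u}} {T S : CovObj 𝒢} (f : T ⟶ S) (W : T.OVertex)

/-- "The path class `q` of `𝔾_S` from `f̄ W` to `a` lifts to `𝔾_T` from `W`": there is a component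
of `𝔾_T` over `a` and a path class to it mapping to `q`. [cite: MochizukiSemiAnbd2006, Prop 3.6 p.38] -/
def CovObj.LiftsTo : (a : Quiver.FreeGroupoid S.orbitGraph.CatCarrier) →
    (S.orbitGraph.basept (Sum.inl (CovObj.OVertex.map f W)) ⟶ a) → Prop
  | ⟨Sum.inl V'⟩, q => ∃ (V : T.OVertex) (e : CovObj.OVertex.map f V = V')
      (p : T.orbitGraph.basept (Sum.inl W) ⟶ T.orbitGraph.basept (Sum.inl V)),
      CovObj.pathMap f p ≫ eqToHom (congrArg (fun X : S.OVertex => S.orbitGraph.basept (Sum.inl X)) e) = q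
  | ⟨Sum.inr E'⟩, q => ∃ (E : T.OEdge) (e : CovObj.OEdge.map f E = E')
      (p : T.orbitGraph.basept (Sum.inl W) ⟶ T.orbitGraph.basept (Sum.inr E)),
      CovObj.pathMap f p ≫ eqToHom (congrArg (fun X : S.OEdge => S.orbitGraph.basept (Sum.inr X)) e) = q

/-- The trivial path lifts. [cite: MochizukiSemiAnbd2006, Prop 3.6 p.38] -/
theorem CovObj.liftsTo_id :
    CovObj.LiftsTo f W (S.orbitGraph.basept (Sum.inl (CovObj.OVertex.map f W))) (𝟙 _) := by
  refine ⟨W, rfl, 𝟙 _, ?_⟩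
  exact (Category.comp_id _).trans
    ((SemiGraph.Hom.mapFundamentalGroupoid (CovObj.orbitGraphMap f)).map_id _)

/-- `f` maps the orbit of `x₀` onto the orbit of `f x₀`: every point of the latter is the image of
a point of the former. [cite: MochizukiSemiAnbd2006, Def 3.5(i) p.37] -/
theorem CovObj.exists_mem_orbit_map_eq {v : 𝒢.graph.Vertex} (x₀ : (T.SV v).obj.V)
    (x' : (S.SV v).obj.V)
    (hx' : (Quot.mk S.VRel ⟨v, x'⟩ : S.OVertex) = Quot.mk S.VRel ⟨v, (f.fV v).hom.hom x₀⟩) :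
    ∃ x : (T.SV v).obj.V, (Quot.mk T.VRel ⟨v, x⟩ : T.OVertex) = Quot.mk T.VRel ⟨v, x₀⟩ ∧
      (f.fV v).hom.hom x = x' := by
  obtain ⟨g, hg⟩ := S.exists_ρ_of_mk_eq_mk hx'.symm
  refine ⟨(T.SV v).obj.ρ g x₀, (Quot.sound (CovObj.VRel.mk (S := T) v g x₀)).symm, ?_⟩
  rw [CovHom.fV_ρ, hg]

/-- Forward lifting step: across the arrow of the branch `(b, E')` of `𝔾_S` abutting to `V'`.
[cite: MochizukiSemiAnbd2006, Prop 3.6 p.38] -/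
theorem CovObj.liftsTo_forward (b : 𝒢.graph.Branch) (E' : S.OEdge)
    (hE' : CovObj.OEdge.base S E' = 𝒢.graph.edgeOf b) (V' : S.OVertex)
    (hv' : S.orbitGraph.abuts ⟨(b, E'), hE'⟩ = some V')
    (q : S.orbitGraph.basept (Sum.inl (CovObj.OVertex.map f W)) ⟶ S.orbitGraph.basept (Sum.inr E'))
    (hq : CovObj.LiftsTo f W (S.orbitGraph.basept (Sum.inr E')) q) :
    CovObj.LiftsTo f W (S.orbitGraph.basept (Sum.inl V'))
      (q ≫ S.orbitGraph.brArrow ⟨(b, E'), hE'⟩ E' V' rfl hv') := by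
  obtain ⟨E, e, p, hp⟩ := hq
  subst e
  -- the branch `(b, E)` of `𝔾_T` and its abutment `V`
  have hE : CovObj.OEdge.base T E = 𝒢.graph.edgeOf b := (CovObj.OEdge.base_map f E).symm.trans hE'
  have hsome := T.glueOpt_isSome b _ (S.orbitGraphProj.abuts_branchMap ⟨(b, _), hE'⟩ V' hv') E hE
  obtain ⟨V, hVeq⟩ := Option.isSome_iff_exists.mp hsome
  have habT : T.orbitGraph.abuts ⟨(b, E), hE⟩ = some V := by
    rw [T.orbitGraph_abuts_of_abuts b E hE _ (S.orbitGraphProj.abuts_branchMap ⟨(b, _), hE'⟩ V' hv')]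
    exact hVeq
  -- its image is `V'`
  have hVV' : CovObj.OVertex.map f V = V' :=
    Option.some.inj (((CovObj.orbitGraphMap f).abuts_branchMap ⟨(b, E), hE⟩ V habT).symm.trans hv')
  subst hVV'
  refine ⟨V, rfl, p ≫ T.orbitGraph.brArrow ⟨(b, E), hE⟩ E V rfl habT, ?_⟩
  have hp' : CovObj.pathMap f p = q := (Category.comp_id _).symm.trans hp
  refine (Category.comp_id _).trans ?_
  rw [CovObj.pathMap_comp, CovObj.pathMap_brArrow, hp']
  exact rfl

/-- Backward lifting step: across the reversed arrow of the branch `(b, E')` of `𝔾_S` abutting to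
`V'` (the edge-orbits of `T` at a lift `V` of `V'` map onto those of `S` at `V'`).
[cite: MochizukiSemiAnbd2006, Prop 3.6 p.38] -/
theorem CovObj.liftsTo_backward (b : 𝒢.graph.Branch) (E' : S.OEdge)
    (hE' : CovObj.OEdge.base S E' = 𝒢.graph.edgeOf b) (V' : S.OVertex)
    (hv' : S.orbitGraph.abuts ⟨(b, E'), hE'⟩ = some V')
    (q : S.orbitGraph.basept (Sum.inl (CovObj.OVertex.map f W)) ⟶ S.orbitGraph.basept (Sum.inl V'))
    (hq : CovObj.LiftsTo f W (S.orbitGraph.basept (Sum.inl V')) q) :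
    CovObj.LiftsTo f W (S.orbitGraph.basept (Sum.inr E'))
      (q ≫ S.orbitGraph.brArrowRev ⟨(b, E'), hE'⟩ E' V' rfl hv') := by
  obtain ⟨V, e, p, hp⟩ := hq
  subst e
  -- representatives: `V = [x₀]`, `E' = [y']`
  revert p hp
  revert hv'
  revert hE'
  induction E' using Quot.ind with
  | mk prE =>
  induction V using Quot.ind with
  | mk prV =>
  obtain ⟨e', y'⟩ := prE
  obtain ⟨v, x₀⟩ := prV
  intro hE' hv' p hp
  cases hE'
  have h : 𝒢.graph.abuts b = some v := S.orbitGraphProj.abuts_branchMap ⟨(b, _), rfl⟩ _ hv'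
  have hV' : (Quot.mk S.VRel ⟨v, (S.glue b v h).hom.hom.hom y'⟩ : S.OVertex) =
      Quot.mk S.VRel ⟨v, (f.fV v).hom.hom x₀⟩ :=
    (Option.some.inj (hv'.symm.trans (S.orbitGraph_abuts_mk b v h ⟨Quot.mk _ ⟨_, y'⟩, rfl⟩ y' rfl))).symm
  obtain ⟨x₁, hx₁, hfx₁⟩ := CovObj.exists_mem_orbit_map_eq f x₀ _ hV'
  -- the edge point `y := glue_T⁻¹ x₁` lies over `y'`
  have hgy : (T.glue b v h).hom.hom.hom ((T.glue b v h).inv.hom.hom x₁) = x₁ := T.glue_hom_inv b v h x₁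
  have hfy : (f.fE _).hom.hom ((T.glue b v h).inv.hom.hom x₁) = y' := by
    have hinj : Function.Injective (fun z => (S.glue b v h).hom.hom.hom z) := fun z₁ z₂ hz => by
      have := congrArg (fun z => (S.glue b v h).inv.hom.hom z) hz
      simpa only [CovObj.glue_inv_hom] using this
    apply hinj
    change (S.glue b v h).hom.hom.hom ((f.fE _).hom.hom _) = (S.glue b v h).hom.hom.hom y'
    rw [CovHom.glue_fE, hgy, hfx₁]
  -- the edge-orbit `E := [y]` of `T` lies over `[y']` and its `b`-branch abuts to `V`
  have hEmap : CovObj.OEdge.map f (Quot.mk T.ERel ⟨_, (T.glue b v h).inv.hom.hom x₁⟩) =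
      Quot.mk S.ERel ⟨_, y'⟩ := by
    change (Quot.mk S.ERel ⟨_, (f.fE _).hom.hom _⟩ : S.OEdge) = _
    rw [hfy]
  have habT : T.orbitGraph.abuts ⟨(b, Quot.mk T.ERel ⟨_, (T.glue b v h).inv.hom.hom x₁⟩), rfl⟩ =
      some (Quot.mk T.VRel ⟨v, x₀⟩) := by
    refine (T.orbitGraph_abuts_mk b v h ⟨Quot.mk _ ⟨_, _⟩, rfl⟩ _ rfl).trans ?_
    rw [hgy]
    exact congrArg some hx₁
  refine ⟨Quot.mk T.ERel ⟨_, (T.glue b v h).inv.hom.hom x₁⟩, hEmap,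
    p ≫ T.orbitGraph.brArrowRev ⟨(b, _), rfl⟩ _ _ rfl habT, ?_⟩
  -- images: `f̄_* (p ≫ b̃_T⁻¹) = f̄_* p ≫ (f̄_* b̃_T)⁻¹`
  rw [CovObj.pathMap_comp, SemiGraph.brArrowRev_eq_inv, CovObj.pathMap_inv, CovObj.pathMap_brArrow,
    SemiGraph.brArrowRev_eq_inv]
  have hp' : CovObj.pathMap f p = q := (Category.comp_id _).symm.trans hp
  subst hp'
  -- compare the two downstairs arrows (same branch up to the equality `f̄ [y] = [y']`)
  have aux : ∀ (E₁ : S.OEdge) (e₁ : CovObj.OEdge.map f (Quot.mk T.ERel ⟨_, (T.glue b v h).inv.hom.hom x₁⟩) = E₁)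
      (hE₁ : CovObj.OEdge.base S E₁ = 𝒢.graph.edgeOf b)
      (h₁ : S.orbitGraph.abuts ⟨(b, E₁), hE₁⟩ = some (Quot.mk S.VRel ⟨v, (f.fV v).hom.hom x₀⟩))
      (hE₂ : CovObj.OEdge.base S
        (CovObj.OEdge.map f (Quot.mk T.ERel ⟨_, (T.glue b v h).inv.hom.hom x₁⟩)) = 𝒢.graph.edgeOf b)
      (h₂ : S.orbitGraph.abuts ⟨(b, CovObj.OEdge.map f
        (Quot.mk T.ERel ⟨_, (T.glue b v h).inv.hom.hom x₁⟩)), hE₂⟩ =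
        some (Quot.mk S.VRel ⟨v, (f.fV v).hom.hom x₀⟩))
      (H : S.orbitGraph.basept (Sum.inr (CovObj.OEdge.map f
        (Quot.mk T.ERel ⟨_, (T.glue b v h).inv.hom.hom x₁⟩))) = S.orbitGraph.basept (Sum.inr E₁)),
      (CovObj.pathMap f p ≫ inv (S.orbitGraph.brArrow ⟨(b, _), hE₂⟩ _ _ rfl h₂)) ≫ eqToHom H =
        CovObj.pathMap f p ≫ inv (S.orbitGraph.brArrow ⟨(b, E₁), hE₁⟩ E₁ _ rfl h₁) := by
    intro E₁ e₁ hE₁ h₁ hE₂ h₂ H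
    subst e₁
    exact Category.comp_id _
  exact aux _ hEmap _ _ _ _ _

/-- One zigzag step of lifting. [cite: MochizukiSemiAnbd2006, Prop 3.6 p.38] -/
private theorem liftsTo_step (y z : S.orbitGraph.CatCarrier)
    (g : @Quiver.Hom (Quiver.Symmetrify S.orbitGraph.CatCarrier)
      (@Quiver.symmetrifyQuiver _ S.orbitGraph.catQuiver) y z)
    (r : S.orbitGraph.basept (Sum.inl (CovObj.OVertex.map f W)) ⟶ S.orbitGraph.basept y)
    (hr : CovObj.LiftsTo f W (S.orbitGraph.basept y) r) :
    CovObj.LiftsTo f W (S.orbitGraph.basept z) (r ≫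
      (CategoryTheory.Quotient.functor
        (@Quiver.FreeGroupoid.redStep S.orbitGraph.CatCarrier S.orbitGraph.catQuiver)).map
        (@Quiver.Hom.toPath (Quiver.Symmetrify S.orbitGraph.CatCarrier)
          (@Quiver.symmetrifyQuiver _ S.orbitGraph.catQuiver) y z g)) := by
  revert g r
  refine Sum.rec (fun V => ?_) (fun E => ?_) y <;> refine Sum.rec (fun V' => ?_) (fun E' => ?_) z
    <;> intro g r hr <;> rcases g with g | g
  · exact g.elim
  · exact g.elim
  · exact g.elim
  · obtain ⟨⟨⟨b, E₀⟩, hE₀⟩, he, hv⟩ := g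
    change E₀ = E' at he
    subst he
    exact CovObj.liftsTo_backward f W b E₀ hE₀ V hv r hr
  · obtain ⟨⟨⟨b, E₀⟩, hE₀⟩, he, hv⟩ := g
    change E₀ = E at he
    subst he
    exact CovObj.liftsTo_forward f W b E₀ hE₀ V' hv r hr
  · exact g.elim
  · exact g.elim
  · exact g.elim

/-- **Path lifting**: every path class of `𝔾_S` from `f̄ W` lifts to `𝔾_T` from `W`.
[cite: MochizukiSemiAnbd2006, Prop 3.6 p.38] -/
theorem CovObj.liftsTo_all {a : Quiver.FreeGroupoid S.orbitGraph.CatCarrier}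
    (q : S.orbitGraph.basept (Sum.inl (CovObj.OVertex.map f W)) ⟶ a) : CovObj.LiftsTo f W a q := by
  have main : ∀ {a a' : Quiver.FreeGroupoid S.orbitGraph.CatCarrier} (r : a ⟶ a')
      (q : S.orbitGraph.basept (Sum.inl (CovObj.OVertex.map f W)) ⟶ a),
      CovObj.LiftsTo f W a q → CovObj.LiftsTo f W a' (q ≫ r) := by
    intro a a' r
    refine CategoryTheory.Quotient.induction
      (r := @Quiver.FreeGroupoid.redStep S.orbitGraph.CatCarrier S.orbitGraph.catQuiver)
      (P := fun {x y} r => ∀ q, CovObj.LiftsTo f W x q → CovObj.LiftsTo f W y (q ≫ r)) ?_ r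
    intro x' y' path
    induction path with
    | nil =>
      intro q hq
      have hid : (CategoryTheory.Quotient.functor
          (@Quiver.FreeGroupoid.redStep S.orbitGraph.CatCarrier S.orbitGraph.catQuiver)).map
            (𝟙 ((Paths.of (Quiver.Symmetrify S.orbitGraph.CatCarrier)).obj x')) = 𝟙 _ :=
        CategoryTheory.Functor.map_id _ _
      exact hid ▸ (Category.comp_id q).symm ▸ hq
    | cons path g ih =>
      intro q hq
      rename_i y'' z
      have hcons : (CategoryTheory.Quotient.functor
          (@Quiver.FreeGroupoid.redStep S.orbitGraph.CatCarrier S.orbitGraph.catQuiver)).map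
            (@Quiver.Path.cons (Quiver.Symmetrify S.orbitGraph.CatCarrier)
              (@Quiver.symmetrifyQuiver _ S.orbitGraph.catQuiver) x' y'' z path g) =
          (CategoryTheory.Quotient.functor
            (@Quiver.FreeGroupoid.redStep S.orbitGraph.CatCarrier S.orbitGraph.catQuiver)).map path ≫
          (CategoryTheory.Quotient.functor
            (@Quiver.FreeGroupoid.redStep S.orbitGraph.CatCarrier S.orbitGraph.catQuiver)).map
            (@Quiver.Hom.toPath (Quiver.Symmetrify S.orbitGraph.CatCarrier)
              (@Quiver.symmetrifyQuiver _ S.orbitGraph.catQuiver) y'' z g) := by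
        rw [← CategoryTheory.Functor.map_comp]
        rfl
      have key : (q ≫ (CategoryTheory.Quotient.functor
            (@Quiver.FreeGroupoid.redStep S.orbitGraph.CatCarrier S.orbitGraph.catQuiver)).map path) ≫
          (CategoryTheory.Quotient.functor
            (@Quiver.FreeGroupoid.redStep S.orbitGraph.CatCarrier S.orbitGraph.catQuiver)).map
            (@Quiver.Hom.toPath (Quiver.Symmetrify S.orbitGraph.CatCarrier)
              (@Quiver.symmetrifyQuiver _ S.orbitGraph.catQuiver) y'' z g) =
          q ≫ (CategoryTheory.Quotient.functor
            (@Quiver.FreeGroupoid.redStep S.orbitGraph.CatCarrier S.orbitGraph.catQuiver)).map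
            (@Quiver.Path.cons (Quiver.Symmetrify S.orbitGraph.CatCarrier)
              (@Quiver.symmetrifyQuiver _ S.orbitGraph.catQuiver) x' y'' z path g) := by
        rw [hcons]; exact Category.assoc _ _ _
      exact key ▸ liftsTo_step f W y'' z g _ (ih q hq)
  have h := main q (𝟙 _) (CovObj.liftsTo_id f W)
  rwa [Category.id_comp] at h

/-- **`π : 𝒢_{∞,T} → 𝒢_{∞,S}` is surjective on every vertex fibre.**
[cite: MochizukiSemiAnbd2006, Prop 3.6 p.38] -/
theorem CovObj.univCoverOverMap_fV_surjective (h𝒢 : 𝒢.IsCountable) (v : 𝒢.graph.Vertex) :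
    Function.Surjective ((CovObj.univCoverOverMap f (Sum.inl W) h𝒢).fV v).hom.hom := by
  intro u
  cases u with | mk V' yq =>
  cases yq with | mk yy q =>
  cases yy with | mk y' hy' =>
  cases V' with | mk V' hV' =>
  change CovObj.OVertex.base S V' = v at hV'
  subst hV'
  obtain ⟨V, e, p, hp⟩ := CovObj.liftsTo_all f W (a := S.orbitGraph.basept (Sum.inl V')) q
  subst e
  have hp' : CovObj.pathMap f p = q := (Category.comp_id _).symm.trans hp
  clear hp
  revert p
  induction V using Quot.ind with
  | mk prV =>
  obtain ⟨v, x₀⟩ := prV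
  intro p hp'
  obtain ⟨x, hx, hfx⟩ := CovObj.exists_mem_orbit_map_eq f x₀ y' hy'
  refine ⟨⟨⟨Quot.mk T.VRel ⟨v, x₀⟩, rfl⟩, ⟨⟨x, hx⟩, p⟩⟩, ?_⟩
  exact CovObj.FibV.ext S (Sum.inl (CovObj.OVertex.map f W)) rfl hfx (heq_of_eq hp')

end ProfiniteSemiGraph

end Literature.AnabelianGeometry.SemiGraphs
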